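import Literature.NumberTheory.NumberFields.CyclicCubicField13
import Mathlib.NumberTheory.NumberField.ClassNumber
import Literature.NumberTheory.EllipticCurves.KummerSelmerGroupFinite
import HarnessLib

/-!
# The cyclic cubic field of conductor `13`: class number one, the primes above `2, 3, 5`, residue maps

Second file on `K = ℚ(θ)`, `θ³ + θ² - 4θ + 1 = 0` (`CyclicCubicField13.lean`: `𝓞 K = ℤ[θ]`,
`d_K = 169`, `Gal(K/ℚ) = ⟨σ⟩`, units modulo squares), supplying the arithmetic needed for an
explicit `2`-descent over `K` (the smallest cubic subfield of the field `F₃` of Dokchitser–Dokchitser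
2011, proof of Thm. 2; tree files `Literature/Barriers/BirchSwinnertonDyer/RankNotSumOfLocalInvariantsF3*.lean`).
Everything is PROVED:

* **Dedekind–Kummer** for `𝓞 K = ℤ[θ]` (exponent `1`): `exists_factor_of_mem_primesOver` (a prime
  above `p` is `(p, Q(θ))` for a lift `Q` of its factor of `f mod p`), `eq_span_of_no_root` (no root
  mod `p` ⇒ `P = (p)`, residue degree `3`).
* **Class number one**: `floor_minkowskiBound_le_three` (`M_K ≤ (4/3.14)(2/9)·13 < 4`, using only
  `r₂ ≤ 1`), `instIsPrincipalIdealRing` (the primes of norm `≤ 3` lie over `2, 3`, where `f` has no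
  root), `exists_eq_span_singleton`.
* **`2` and `3` are inert**: `span_two`, `span_three` (`(2)`, `(3)` prime of residue degree `3`, the
  only primes above `2`, `3`).
* **`5 = 𝔭₁𝔭₂𝔭₃` splits**: `norm_θint_sub` (`N(θ - m) = -f(m)`), `isPrime_span_θint_sub` (`(θ+1)`,
  `(θ-2)`, `(θ+2)` are prime of norm `5`), `five_eq_mul₁₂₃` (`5 ∈ (θ - c)`), `cubicPolyMod_five`
  (`f ≡ (X+1)(X-2)(X+2) mod 5`), `eq_of_mem_primesOver_five` (every prime above `5` is one of the
  three), `span_θint_sub_ne` (they are distinct).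
* **Residue maps**: `exists_ringEquiv_adjoinRoot` (`ℤ[X]/(f) ≅ 𝓞 K`), `exists_ringHom_apply_θint`
  (`𝓞 K → R`, `θ ↦ r` for any root `r` of `f` in `R`), `ker_eq_span_of_apply_θint` (at `𝔭 = (θ - c)`
  above `5`: `𝓞 K → 𝔽₅`, kernel `(θ - c)`), `F8`, `F27` (`𝔽_p[X]/(f)`, fields), `exists_residueMap_inert`
  (`𝓞 K → 𝔽₈, 𝔽₂₇` with kernel `(2)`, `(3)`).
* **`K(∅,2) = 𝓞ˣ/𝓞ˣ²`**: `exists_unit_mul_sq_of_even_valuation` — over any Dedekind PID, an element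
  of the fraction field all of whose valuations are even is a unit times a square (tree:
  `IsDedekindDomain.exists_mk_eq_of_pos`, `exists_pow_eq_span_singleton_of_dvd_count`).

## References

* D. A. Marcus, *Number Fields*, 2nd ed. (2018), Ch. 3, Thm. 27 (Dedekind–Kummer); Ch. 5, Cor. 2 of
  Thm. 37 (Minkowski bound) and the class-number computations following it. [cite: Marcus2018, Ch. 5, Thm. 37]
* T. Dokchitser, V. Dokchitser, J. Number Theory 131 (2011) 1833–1839, proof of Thm. 2.
  [DokchitserDokchitser2011RankModN]

## Design notes

Modelled on the tree's `Literature/Topology/FourManifolds/CappellShanesonClassNumberOne{,Large}.lean`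
(Dedekind–Kummer through `NumberField.Ideal.primesOverSpanEquivMonicFactorsMod`, inert primes, the
Minkowski estimate with `π > 3.14`) and `CappellShanesonClassNumberTwoUnits.lean` (`ℤ[X]/(f) ≅ 𝓞 K`
and residue maps by `AdjoinRoot.lift`). Same grouping namespace
`Literature.NumberTheory.NumberFields.CyclicCubic13`.
-/

noncomputable section

open Polynomial NumberField Algebra Ideal

namespace Literature.NumberTheory.NumberFields

namespace CyclicCubic13

/-! ### Dedekind–Kummer for `𝓞 K = ℤ[θ]` -/

/-- `f mod p`. [folklore] -/
def cubicPolyMod (p : ℕ) : (ZMod p)[X] := cubicPoly.map (Int.castRingHom (ZMod p))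

/-- `f mod p` is monic. [folklore] -/
theorem monic_cubicPolyMod (p : ℕ) [Fact p.Prime] : (cubicPolyMod p).Monic := cubicPoly_monic.map _

/-- `f mod p` has degree `3`. [folklore] -/
theorem natDegree_cubicPolyMod (p : ℕ) [Fact p.Prime] : (cubicPolyMod p).natDegree = 3 := by
  rw [cubicPolyMod, cubicPoly_monic.natDegree_map, cubicPoly_natDegree]

/-- Evaluation of `f mod p`. [folklore] -/
theorem eval_cubicPolyMod (p : ℕ) (c : ZMod p) : (cubicPolyMod p).eval c = c ^ 3 + c ^ 2 - 4 * c + 1 := by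
  simp [cubicPolyMod, cubicPoly]

/-- **Dedekind–Kummer for `𝓞 K = ℤ[θ]`**: a prime `P` of `𝓞 K` above `p` is `(p, Q(θ))` for any
integer lift `Q` of the corresponding monic irreducible factor `Q̄` of `f mod p`, of residue degree
`deg Q̄` (Mathlib's `NumberField.Ideal.primesOverSpanEquivMonicFactorsMod`, exponent `1`).
[folklore] -/
theorem exists_factor_of_mem_primesOver {p : ℕ} (hp : p.Prime) {P : Ideal (𝓞 K)}
    (hP : P ∈ primesOver (span {(p : ℤ)}) (𝓞 K)) :
    ∃ Qb : (ZMod p)[X], Irreducible Qb ∧ Qb.Monic ∧ Qb ∣ cubicPolyMod p ∧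
      P.inertiaDeg ℤ = Qb.natDegree ∧
      ∀ Q : ℤ[X], Q.map (Int.castRingHom (ZMod p)) = Qb → P = span {(p : 𝓞 K), aeval θint Q} := by
  haveI := Fact.mk hp
  have hexp : ¬ p ∣ RingOfIntegers.exponent θint := by
    rw [exponent_θint, Nat.dvd_one]
    exact hp.ne_one
  set e := NumberField.Ideal.primesOverSpanEquivMonicFactorsMod (K := K) hexp with he
  set Qb := e ⟨P, hP⟩ with hQb
  have hmem : (Qb : (ZMod p)[X]) ∈ RingOfIntegers.monicFactorsMod θint p := Qb.2
  have hmem' := hmem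
  simp only [RingOfIntegers.monicFactorsMod, Multiset.mem_toFinset, minpoly_θint] at hmem'
  have h0 : cubicPolyMod p ≠ 0 := (monic_cubicPolyMod p).ne_zero
  obtain ⟨hirr, hmon, hdvd⟩ := (Polynomial.mem_normalizedFactors_iff h0).mp hmem'
  refine ⟨Qb, hirr, hmon, hdvd, ?_, ?_⟩
  · have := NumberField.Ideal.inertiaDeg_primesOverSpanEquivMonicFactorsMod_symm_apply' hexp hmem
    rwa [show (⟨(Qb : (ZMod p)[X]), hmem⟩ : RingOfIntegers.monicFactorsMod θint p) = Qb
      from Subtype.ext rfl, Equiv.symm_apply_apply] at this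
  · intro Q hQ
    have hmemQ : Q.map (Int.castRingHom (ZMod p)) ∈ RingOfIntegers.monicFactorsMod θint p := hQ ▸ hmem
    have h1 := NumberField.Ideal.primesOverSpanEquivMonicFactorsMod_symm_apply_eq_span hexp hmemQ
    have h2 : (⟨Q.map (Int.castRingHom (ZMod p)), hmemQ⟩ :
        RingOfIntegers.monicFactorsMod θint p) = Qb := Subtype.ext hQ
    rw [h2, hQb, Equiv.symm_apply_apply] at h1
    exact h1

/-- `θint` is a root of `f` in `𝓞 K`. [folklore] -/
theorem aeval_θint : aeval θint cubicPoly = 0 := by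
  apply IsFractionRing.injective (𝓞 K) K
  rw [map_zero, ← aeval_algebraMap_apply]
  exact aeval_θ_cubicPoly

/-- **Inert primes**: if `f` has no root modulo `p` (so `f mod p`, a cubic, is irreducible), every
prime of `𝓞 K` above `p` is `(p)`, of residue degree `3`. [folklore] -/
theorem eq_span_of_no_root {p : ℕ} (hp : p.Prime) {P : Ideal (𝓞 K)}
    (hP : P ∈ primesOver (span {(p : ℤ)}) (𝓞 K))
    (hnr : ∀ c : ZMod p, c ^ 3 + c ^ 2 - 4 * c + 1 ≠ 0) :
    P = span {(p : 𝓞 K)} ∧ P.inertiaDeg ℤ = 3 := by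
  haveI := Fact.mk hp
  obtain ⟨Qb, hirr, hmon, hdvd, hdeg, hspan⟩ := exists_factor_of_mem_primesOver hp hP
  have hfirr : Irreducible (cubicPolyMod p) := by
    refine irreducible_of_degree_le_three_of_not_isRoot
      (by rw [natDegree_cubicPolyMod]; decide) fun c hc => hnr c ?_
    rwa [IsRoot.def, eval_cubicPolyMod] at hc
  have hQb : Qb = cubicPolyMod p :=
    eq_of_monic_of_associated hmon (monic_cubicPolyMod p) (hirr.associated_of_dvd hfirr hdvd)
  refine ⟨?_, by rw [hdeg, hQb, natDegree_cubicPolyMod]⟩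
  have h := hspan cubicPoly (by rw [hQb]; rfl)
  rw [aeval_θint] at h
  rw [h, Ideal.span_insert, Ideal.span_singleton_eq_bot.mpr rfl, sup_bot_eq]

/-- `f` has no root modulo `2` (`f ≡ X³ + X² + 1`). [folklore] -/
theorem no_root_two : ∀ c : ZMod 2, c ^ 3 + c ^ 2 - 4 * c + 1 ≠ 0 := by decide

/-- `f` has no root modulo `3` (`f ≡ X³ + X² - X + 1`). [folklore] -/
theorem no_root_three : ∀ c : ZMod 3, c ^ 3 + c ^ 2 - 4 * c + 1 ≠ 0 := by decide

/-! ### The Minkowski bound and class number one -/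

/-- **`⌊M_K⌋ ≤ 3`**: `M_K = (4/π)^{r₂} (3!/3³) √169 ≤ (4/3.14)(6/27)·13 < 4` (using only `r₂ ≤ 1`;
in fact `r₂ = 0` and `M_K ≈ 2.89`). Marcus, *Number Fields*, Ch. 5, Cor. 2 of Thm. 37. [folklore] -/
theorem floor_minkowskiBound_le_three :
    ⌊(4 / Real.pi) ^ InfinitePlace.nrComplexPlaces K *
        ((Module.finrank ℚ K).factorial / (Module.finrank ℚ K : ℝ) ^ Module.finrank ℚ K *
          Real.sqrt |(NumberField.discr K : ℝ)|)⌋₊ ≤ 3 := by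
  have hc : InfinitePlace.nrComplexPlaces K ≤ 1 := by
    have := InfinitePlace.card_add_two_mul_card_eq_rank K
    rw [finrank_K] at this
    omega
  have hπ : (3.14 : ℝ) < Real.pi := Real.pi_gt_d2
  have hsqrt : Real.sqrt |(NumberField.discr K : ℝ)| = 13 := by
    rw [discr_eq]; norm_num
    rw [show (169 : ℝ) = 13 ^ 2 by norm_num, Real.sqrt_sq (by norm_num)]
  rw [finrank_K, hsqrt]
  have hfac : ((3 : ℕ).factorial : ℝ) = 6 := by norm_num [Nat.factorial]
  rw [hfac]
  have hpow : (4 / Real.pi) ^ InfinitePlace.nrComplexPlaces K ≤ 4 / 3.14 := by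
    rcases Nat.le_one_iff_eq_zero_or_eq_one.mp hc with h | h <;> rw [h]
    · norm_num
    · rw [pow_one]
      exact (div_lt_div_of_pos_left (by norm_num) (by norm_num) hπ).le
  refine Nat.le_of_lt_succ ((Nat.floor_lt (by positivity)).mpr ?_)
  have key : (4 / Real.pi) ^ InfinitePlace.nrComplexPlaces K * (6 / (3 : ℝ) ^ 3 * 13) < 4 :=
    lt_of_le_of_lt (mul_le_mul_of_nonneg_right hpow (by positivity)) (by norm_num)
  have h4 : ((Nat.succ 3 : ℕ) : ℝ) = 4 := by norm_num
  rw [h4]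
  exact key

/-- **`𝓞 K = ℤ[θ]` is a principal ideal domain** (class number one of the cyclic cubic field of
conductor `13`): by the Minkowski bound every ideal class contains a prime of norm `≤ 3`, and the
primes above `2` and `3` are `(2)` and `(3)` (`f` has no root mod `2`, `3`). [folklore] -/
instance instIsPrincipalIdealRing : IsPrincipalIdealRing (𝓞 K) := by
  refine RingOfIntegers.isPrincipalIdealRing_of_isPrincipal_of_pow_le_of_mem_primesOver_of_mem_Icc
    fun p hp hprime P hP hle => ?_
  have hpU : p ≤ 3 := (Finset.mem_Icc.mp hp).2.trans floor_minkowskiBound_le_three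
  have h1p : 1 ≤ p := (Finset.mem_Icc.mp hp).1
  interval_cases p
  · exfalso; revert hprime; decide
  · exact ⟨⟨_, by rw [(eq_span_of_no_root hprime hP no_root_two).1, submodule_span_eq]⟩⟩
  · exact ⟨⟨_, by rw [(eq_span_of_no_root hprime hP no_root_three).1, submodule_span_eq]⟩⟩

/-- Every ideal of `𝓞 K` is principal. [folklore] -/
theorem exists_eq_span_singleton (I : Ideal (𝓞 K)) : ∃ β : 𝓞 K, I = span {β} :=
  ⟨_, (IsPrincipalIdealRing.principal I).span_singleton_generator.symm⟩

/-! ### The primes above `2` and `3` (inert) and above `5` (split) -/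

/-- **`(2)` is a prime ideal of `𝓞 K` of residue degree `3`** (`2` is inert: `f` is irreducible
mod `2`), and it is the only prime above `2`. [folklore] -/
theorem span_two :
    (span {(2 : 𝓞 K)}).IsPrime ∧ (span {(2 : 𝓞 K)}).inertiaDeg ℤ = 3 ∧
      ∀ P ∈ primesOver (span {(2 : ℤ)}) (𝓞 K), P = span {(2 : 𝓞 K)} := by
  have hall : ∀ P ∈ primesOver (span {((2 : ℕ) : ℤ)}) (𝓞 K),
      P = span {((2 : ℕ) : 𝓞 K)} ∧ P.inertiaDeg ℤ = 3 :=
    fun P hP => eq_span_of_no_root Nat.prime_two hP no_root_two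
  simp only [Nat.cast_ofNat] at hall
  haveI : Fact (Nat.Prime 2) := ⟨Nat.prime_two⟩
  haveI : (span {(2 : ℤ)}).IsPrime := by
    have h := (Int.ideal_span_isMaximal_of_prime 2).isPrime
    simpa using h
  obtain ⟨⟨P, hP⟩⟩ := Ideal.nonempty_primesOver (S := 𝓞 K) (span {(2 : ℤ)})
  obtain ⟨hPeq, hdeg⟩ := hall P hP
  subst hPeq
  exact ⟨hP.1, hdeg, fun Q hQ => (hall Q hQ).1⟩

/-- **`(3)` is a prime ideal of `𝓞 K` of residue degree `3`** (`3` is inert), the only prime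
above `3`. [folklore] -/
theorem span_three :
    (span {(3 : 𝓞 K)}).IsPrime ∧ (span {(3 : 𝓞 K)}).inertiaDeg ℤ = 3 ∧
      ∀ P ∈ primesOver (span {(3 : ℤ)}) (𝓞 K), P = span {(3 : 𝓞 K)} := by
  have hall : ∀ P ∈ primesOver (span {((3 : ℕ) : ℤ)}) (𝓞 K),
      P = span {((3 : ℕ) : 𝓞 K)} ∧ P.inertiaDeg ℤ = 3 :=
    fun P hP => eq_span_of_no_root Nat.prime_three hP no_root_three
  simp only [Nat.cast_ofNat] at hall
  haveI : Fact (Nat.Prime 3) := ⟨Nat.prime_three⟩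
  haveI : (span {(3 : ℤ)}).IsPrime := by
    have h := (Int.ideal_span_isMaximal_of_prime 3).isPrime
    simpa using h
  obtain ⟨⟨P, hP⟩⟩ := Ideal.nonempty_primesOver (S := 𝓞 K) (span {(3 : ℤ)})
  obtain ⟨hPeq, hdeg⟩ := hall P hP
  subst hPeq
  exact ⟨hP.1, hdeg, fun Q hQ => (hall Q hQ).1⟩

/-! ### The split prime `5 = 𝔭₁ 𝔭₂ 𝔭₃`: `𝔭 = (θ + 1), (θ - 2), (θ + 2)` -/

/-- Norms of the elements `θ - m`, `m ∈ ℤ`: `N(θ - m) = -f(m)`. [folklore] -/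
theorem norm_θint_sub (m : ℤ) : Algebra.norm ℤ (θint - m : 𝓞 K) = -(m ^ 3 + m ^ 2 - 4 * m + 1) := by
  have h := Algebra.coe_norm_int (θint - m : 𝓞 K)
  have hK : ((θint - m : 𝓞 K) : K) = ((0 : ℚ) : K) * θ ^ 2 + ((1 : ℚ) : K) * θ + ((-m : ℚ) : K) := by
    rw [RingOfIntegers.coe_eq_algebraMap, map_sub, map_intCast,
      show algebraMap (𝓞 K) K θint = θ from rfl]
    push_cast; ring
  rw [hK, norm_quadratic] at h
  have h' : ((Algebra.norm ℤ (θint - m : 𝓞 K) : ℤ) : ℚ) = ((-(m ^ 3 + m ^ 2 - 4 * m + 1) : ℤ) : ℚ) := by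
    rw [h]; push_cast; ring
  exact_mod_cast h'

/-- `N((θ - m)) = |f(m)|`. [folklore] -/
theorem absNorm_span_θint_sub (m : ℤ) :
    absNorm (span {(θint - m : 𝓞 K)}) = (m ^ 3 + m ^ 2 - 4 * m + 1).natAbs := by
  rw [absNorm_span_singleton, norm_θint_sub, Int.natAbs_neg]

/-- **The primes above `5`**: `𝔭(c) = (θ - c)` for `c = -1, 2, -2` (the roots of `f` mod `5`,
`f ≡ (X + 1)(X - 2)(X + 2)`), each of norm `5` (`f(-1) = 5`, `f(2) = 5`, `f(-2) = 5`), hence prime.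
[folklore] -/
theorem isPrime_span_θint_sub {c : ℤ} (hc : c = -1 ∨ c = 2 ∨ c = -2) :
    (span {(θint - c : 𝓞 K)}).IsPrime ∧ absNorm (span {(θint - c : 𝓞 K)}) = 5 := by
  have h5 : absNorm (span {(θint - c : 𝓞 K)}) = 5 := by
    rw [absNorm_span_θint_sub]
    rcases hc with rfl | rfl | rfl <;> norm_num
  exact ⟨Ideal.isPrime_of_irreducible_absNorm (by rw [h5]; exact Nat.prime_five), h5⟩

/-- `5 = (θ + 1)(4 - θ²)`: `f = (X + 1)(X² - 4) + 5`. [folklore] -/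
theorem five_eq_mul₁ : (5 : 𝓞 K) = (θint + 1) * (4 - θint ^ 2) := by linear_combination θint_rel

/-- `5 = (θ - 2)(-θ² - 3θ - 2)`: `f = (X - 2)(X² + 3X + 2) + 5`. [folklore] -/
theorem five_eq_mul₂ : (5 : 𝓞 K) = (θint - 2) * (-θint ^ 2 - 3 * θint - 2) := by
  linear_combination θint_rel

/-- `5 = (θ + 2)(-θ² + θ + 2)`: `f = (X + 2)(X² - X - 2) + 5`. [folklore] -/
theorem five_eq_mul₃ : (5 : 𝓞 K) = (θint + 2) * (-θint ^ 2 + θint + 2) := by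
  linear_combination θint_rel

/-- `f mod p` written out. [folklore] -/
theorem cubicPolyMod_eq (p : ℕ) : cubicPolyMod p = X ^ 3 + X ^ 2 - C (4 : ZMod p) * X + C 1 := by
  rw [cubicPolyMod, cubicPoly, Polynomial.map_add, Polynomial.map_sub, Polynomial.map_add,
    Polynomial.map_pow, Polynomial.map_pow, map_X, Polynomial.map_mul, Polynomial.map_C,
    Polynomial.map_C, map_X, map_ofNat, map_one]

/-- `f ≡ (X + 1)(X - 2)(X + 2) (mod 5)`. [folklore] -/
theorem cubicPolyMod_five :
    cubicPolyMod 5 = (X - C (-1 : ZMod 5)) * (X - C (2 : ZMod 5)) * (X - C (-2 : ZMod 5)) := by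
  rw [cubicPolyMod_eq, C_neg, C_neg, C_1]
  have h2 : (C (2 : ZMod 5)) = (2 : (ZMod 5)[X]) := map_ofNat C 2
  have h4 : (C (4 : ZMod 5)) = (4 : (ZMod 5)[X]) := map_ofNat C 4
  have h5 : (5 : (ZMod 5)[X]) = 0 := by
    rw [show (5 : (ZMod 5)[X]) = C 5 from (map_ofNat C 5).symm, show (5 : ZMod 5) = 0 from rfl, C_0]
  rw [h2, h4]
  linear_combination h5

/-- `(5, θ - c) = (θ - c)` when `5 ∈ (θ - c)`. [folklore] -/
theorem span_five_pair_eq {c : 𝓞 K} (h5 : (5 : 𝓞 K) ∈ span {θint - c}) :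
    span {(5 : 𝓞 K), θint - c} = span {θint - c} := by
  rw [Ideal.span_insert, sup_eq_right]
  exact (span_singleton_le_iff_mem _).mpr h5

/-- The integer lift `X - m` of the linear factor `X - m̄` of `f mod 5`, and its value `θ - m` at `θ`.
[folklore] -/
theorem map_X_sub_C_and_aeval (m : ℤ) :
    (X - C m : ℤ[X]).map (Int.castRingHom (ZMod 5)) = X - C (m : ZMod 5) ∧
      aeval θint (X - C m : ℤ[X]) = θint - m := by
  constructor
  · rw [Polynomial.map_sub, map_X, Polynomial.map_C, eq_intCast]
  · rw [map_sub, aeval_X, aeval_C, algebraMap_int_eq, eq_intCast]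

/-- **Every prime of `𝓞 K` above `5` is one of `(θ + 1)`, `(θ - 2)`, `(θ + 2)`** (Dedekind–Kummer:
its factor of `f mod 5 = (X+1)(X-2)(X+2)` is one of the three linear factors, and
`(5, θ - c) = (θ - c)` as `5 ∈ (θ - c)`). [folklore] -/
theorem eq_of_mem_primesOver_five {P : Ideal (𝓞 K)} (hP : P ∈ primesOver (span {(5 : ℤ)}) (𝓞 K)) :
    P = span {(θint + 1 : 𝓞 K)} ∨ P = span {(θint - 2 : 𝓞 K)} ∨ P = span {(θint + 2 : 𝓞 K)} := by
  haveI : Fact (Nat.Prime 5) := ⟨Nat.prime_five⟩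
  obtain ⟨Qb, hirr, hmon, hdvd, -, hspan⟩ :=
    exists_factor_of_mem_primesOver (p := 5) Nat.prime_five (by simpa using hP)
  simp only [Nat.cast_ofNat] at hspan
  rw [cubicPolyMod_five] at hdvd
  have key : ∀ c : ZMod 5, Qb ∣ X - C c → Qb = X - C c := fun c hc =>
    eq_of_monic_of_associated hmon (monic_X_sub_C c) (hirr.associated_of_dvd (irreducible_X_sub_C c) hc)
  -- `P = (5, θ - m) = (θ - m)` once `Qb = X - m̄`
  have conclude : ∀ m : ℤ, Qb = X - C (m : ZMod 5) → (5 : 𝓞 K) ∈ span {θint - (m : 𝓞 K)} →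
      P = span {θint - (m : 𝓞 K)} := by
    intro m hQ h5
    obtain ⟨hmap, hev⟩ := map_X_sub_C_and_aeval m
    have h := hspan (X - C m) (by rw [hmap, hQ])
    rw [hev] at h
    rw [h, span_five_pair_eq h5]
  rcases hirr.prime.dvd_or_dvd hdvd with h12 | h3
  · rcases hirr.prime.dvd_or_dvd h12 with h1 | h2
    · refine Or.inl ?_
      have := conclude (-1) (by rw [key _ h1]; push_cast; rfl) (by
        push_cast; rw [sub_neg_eq_add, five_eq_mul₁]; exact Ideal.mul_mem_right _ _ (subset_span rfl))
      rw [this]; push_cast; rw [sub_neg_eq_add]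
    · refine Or.inr (Or.inl ?_)
      have := conclude 2 (by rw [key _ h2]; push_cast; rfl) (by
        push_cast; rw [five_eq_mul₂]; exact Ideal.mul_mem_right _ _ (subset_span rfl))
      rw [this]; push_cast; rfl
  · refine Or.inr (Or.inr ?_)
    have := conclude (-2) (by rw [key _ h3]; push_cast; rfl) (by
      push_cast; rw [sub_neg_eq_add, five_eq_mul₃]; exact Ideal.mul_mem_right _ _ (subset_span rfl))
    rw [this]; push_cast; rw [sub_neg_eq_add]

/-- The three primes above `5` are pairwise distinct (their pairwise "differences" `3, 1, 4` are
prime to `5`, so a common prime would contain `1`). [folklore] -/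
theorem span_θint_sub_ne :
    span {(θint + 1 : 𝓞 K)} ≠ span {(θint - 2 : 𝓞 K)} ∧ span {(θint + 1 : 𝓞 K)} ≠ span {(θint + 2 : 𝓞 K)} ∧
      span {(θint - 2 : 𝓞 K)} ≠ span {(θint + 2 : 𝓞 K)} := by
  have hP : ∀ {c : ℤ}, (c = -1 ∨ c = 2 ∨ c = -2) → span {(θint - c : 𝓞 K)} ≠ ⊤ := fun hc =>
    (isPrime_span_θint_sub hc).1.ne_top
  have h5 : ∀ {c : 𝓞 K}, (5 : 𝓞 K) ∈ span {θint - c} → ∀ {d : 𝓞 K}, span {θint - c} = span {θint - d} →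
      (c - d : 𝓞 K) ∈ span {θint - c} := by
    intro c h5 d hcd
    have hd : (θint - d : 𝓞 K) ∈ span {θint - c} := by rw [hcd]; exact subset_span rfl
    have := Ideal.sub_mem _ hd (subset_span rfl : (θint - c : 𝓞 K) ∈ span {θint - c})
    rwa [show θint - d - (θint - c) = c - d from by ring] at this
  have mem₁ : (5 : 𝓞 K) ∈ span {θint - (-1 : 𝓞 K)} := by
    rw [sub_neg_eq_add, five_eq_mul₁]; exact Ideal.mul_mem_right _ _ (subset_span rfl)
  have mem₂ : (5 : 𝓞 K) ∈ span {θint - (2 : 𝓞 K)} := by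
    rw [five_eq_mul₂]; exact Ideal.mul_mem_right _ _ (subset_span rfl)
  refine ⟨fun h => ?_, fun h => ?_, fun h => ?_⟩
  · -- `(θ+1) = (θ-2)`: `-1 - 2 = -3 ∈ 𝔭`, `5 ∈ 𝔭`, so `1 = 2·(-3) + 5 + 2 ∈ 𝔭`... precisely `1 = -2·(-3) - 5`
    have h3 : ((-1 : 𝓞 K) - 2) ∈ span {θint - (-1 : 𝓞 K)} := h5 mem₁ (by rw [sub_neg_eq_add]; exact h)
    apply hP (c := -1) (Or.inl rfl)
    rw [Ideal.eq_top_iff_one]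
    have := Ideal.sub_mem _ (Ideal.mul_mem_left _ (-2) h3) mem₁
    push_cast
    convert this using 1
    ring
  · have h1 : ((-1 : 𝓞 K) - (-2)) ∈ span {θint - (-1 : 𝓞 K)} :=
      h5 mem₁ (by rw [sub_neg_eq_add, sub_neg_eq_add]; exact h)
    apply hP (c := -1) (Or.inl rfl)
    rw [Ideal.eq_top_iff_one]
    push_cast
    convert h1 using 1
    ring
  · have h4 : ((2 : 𝓞 K) - (-2)) ∈ span {θint - (2 : 𝓞 K)} := h5 mem₂ (by rw [sub_neg_eq_add]; exact h)
    apply hP (c := 2) (Or.inr (Or.inl rfl))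
    rw [Ideal.eq_top_iff_one]
    have := Ideal.sub_mem _ mem₂ h4
    push_cast
    convert this using 1
    ring

/-! ### Residue maps `𝓞 K = ℤ[θ] → R`, `θ ↦ r` for a root `r` of `f` in `R` -/

/-- **`ℤ[X]/(f) ≅ 𝓞 K`**, the root going to `θ` (`minpoly_ℤ θ = f`, `ℤ[θ] = 𝓞 K`; Mathlib's
`minpoly.equivAdjoin`). [folklore] -/
theorem exists_ringEquiv_adjoinRoot :
    ∃ e : AdjoinRoot cubicPoly ≃+* 𝓞 K, e (AdjoinRoot.root cubicPoly) = θint := by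
  have key : ∀ g : ℤ[X], g = minpoly ℤ θint →
      ∃ e : AdjoinRoot g ≃+* 𝓞 K, e (AdjoinRoot.root g) = θint := by
    intro g hg
    subst hg
    have hint : IsIntegral ℤ θint := Algebra.IsIntegral.isIntegral _
    let e₁ := minpoly.equivAdjoin hint
    let e₂ : Algebra.adjoin ℤ ({θint} : Set (𝓞 K)) ≃ₐ[ℤ] 𝓞 K :=
      (Subalgebra.equivOfEq _ _ adjoin_θint_eq_top).trans Subalgebra.topEquiv
    refine ⟨(e₁.trans e₂).toRingEquiv, ?_⟩
    have h1 : ((e₁ (AdjoinRoot.root _) : Algebra.adjoin ℤ ({θint} : Set (𝓞 K))) : 𝓞 K) = θint := by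
      change ((minpoly.equivAdjoin hint (AdjoinRoot.mk _ X) : Algebra.adjoin ℤ _) : 𝓞 K) = _
      rw [minpoly.coe_equivAdjoin]
      exact AdjoinRoot.Minpoly.coe_toAdjoin_mk_X
    have h2 : ∀ y, e₂ y = (y : 𝓞 K) := fun y => rfl
    change e₂ (e₁ (AdjoinRoot.root _)) = θint
    rw [h2, h1]
  exact key cubicPoly minpoly_θint.symm

/-- **Residue maps**: for every commutative ring `R` and every root `r ∈ R` of `f`, there is a ring
homomorphism `ψ : 𝓞 K = ℤ[θ] → R` with `ψ(θ) = r` (through `ℤ[X]/(f) ≅ 𝓞 K`). [folklore] -/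
theorem exists_ringHom_apply_θint {R : Type*} [CommRing R] (r : R) (hr : r ^ 3 + r ^ 2 - 4 * r + 1 = 0) :
    ∃ ψ : 𝓞 K →+* R, ψ θint = r := by
  obtain ⟨e, he⟩ := exists_ringEquiv_adjoinRoot
  have hev : cubicPoly.eval₂ (Int.castRingHom R) r = 0 := by
    rw [cubicPoly, eval₂_add, eval₂_sub, eval₂_add, eval₂_X_pow, eval₂_X_pow, eval₂_mul, eval₂_C,
      eval₂_X, eval₂_C, map_ofNat, map_one]
    exact hr
  refine ⟨(AdjoinRoot.lift (Int.castRingHom R) r hev).comp e.symm.toRingHom, ?_⟩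
  rw [RingHom.comp_apply]
  change AdjoinRoot.lift _ _ hev (e.symm θint) = _
  rw [← he, e.symm_apply_apply, AdjoinRoot.lift_root]

/-- **The residue map at `𝔭 = (θ - c)` above `5`**, `ψ : 𝓞 K → 𝔽₅`, `θ ↦ c̄` (`c = -1, 2, -2`):
its kernel is `(θ - c)`, so `z ∈ (θ - c) ↔ ψ(z) = 0`. [folklore] -/
theorem ker_eq_span_of_apply_θint {c : ℤ} (hc : c = -1 ∨ c = 2 ∨ c = -2) (ψ : 𝓞 K →+* ZMod 5)
    (hψ : ψ θint = (c : ZMod 5)) : RingHom.ker ψ = span {(θint - c : 𝓞 K)} := by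
  have hle : span {(θint - c : 𝓞 K)} ≤ RingHom.ker ψ := by
    rw [span_singleton_le_iff_mem, RingHom.mem_ker, map_sub, hψ, map_intCast, sub_self]
  obtain ⟨hprime, h5⟩ := isPrime_span_θint_sub hc
  haveI := hprime
  haveI : Fact (1 < 5) := ⟨by norm_num⟩
  have hmax : (span {(θint - c : 𝓞 K)}).IsMaximal :=
    IsPrime.isMaximal inferInstance (by
      intro h
      rw [h, Ideal.absNorm_bot] at h5
      exact absurd h5 (by norm_num))
  exact (hmax.eq_of_le (RingHom.ker_ne_top ψ) hle).symm


/-! ### The residue fields `𝓞/(2) = 𝔽₈` and `𝓞/(3) = 𝔽₂₇` -/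

/-- `f mod 3` is irreducible (no root), as a `Fact` (so `𝔽₂₇ = 𝔽₃[X]/(f)` is a field). [folklore] -/
instance fact_irreducible_cubicPolyMod_three : Fact (Irreducible (cubicPolyMod 3)) :=
  ⟨irreducible_of_degree_le_three_of_not_isRoot (by rw [natDegree_cubicPolyMod]; decide)
    fun c hc => no_root_three c (by rwa [IsRoot.def, eval_cubicPolyMod] at hc)⟩

/-- `f mod 2` is irreducible (no root), as a `Fact` (so `𝔽₈ = 𝔽₂[X]/(f)` is a field). [folklore] -/
instance fact_irreducible_cubicPolyMod_two : Fact (Irreducible (cubicPolyMod 2)) :=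
  ⟨irreducible_of_degree_le_three_of_not_isRoot (by rw [natDegree_cubicPolyMod]; decide)
    fun c hc => no_root_two c (by rwa [IsRoot.def, eval_cubicPolyMod] at hc)⟩

/-- **The residue field at `(3)`**: `𝔽₂₇ = 𝔽₃[X]/(f)`. [folklore] -/
abbrev F27 : Type := AdjoinRoot (cubicPolyMod 3)

/-- **The residue field at `(2)`**: `𝔽₈ = 𝔽₂[X]/(f)`. [folklore] -/
abbrev F8 : Type := AdjoinRoot (cubicPolyMod 2)

/-- The class of `X` in `𝔽_p[X]/(f)` is a root of `f`. [folklore] -/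
theorem root_rel (p : ℕ) :
    (AdjoinRoot.root (cubicPolyMod p)) ^ 3 + (AdjoinRoot.root (cubicPolyMod p)) ^ 2 -
      4 * AdjoinRoot.root (cubicPolyMod p) + 1 = 0 := by
  have h : eval₂ (AdjoinRoot.of (cubicPolyMod p)) (AdjoinRoot.root (cubicPolyMod p))
      (cubicPoly.map (Int.castRingHom (ZMod p))) = 0 := AdjoinRoot.eval₂_root _
  rw [eval₂_map, cubicPoly, eval₂_add, eval₂_sub, eval₂_add, eval₂_X_pow, eval₂_X_pow, eval₂_mul,
    eval₂_C, eval₂_X, eval₂_C, map_ofNat, map_one] at h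
  exact h

/-- **The residue map `ψ_p : 𝓞 K → 𝔽_p[X]/(f)`, `θ ↦ X̄`, at an inert prime `p ∈ {2, 3}` has kernel
`(p)`**: so `z ≡ z' (mod p𝓞)` iff `ψ_p z = ψ_p z'`. [folklore] -/
theorem exists_residueMap_inert {p : ℕ} (hp : p = 2 ∨ p = 3) :
    ∃ ψ : 𝓞 K →+* AdjoinRoot (cubicPolyMod p), ψ θint = AdjoinRoot.root _ ∧
      RingHom.ker ψ = span {(p : 𝓞 K)} := by
  obtain ⟨ψ, hψ⟩ := exists_ringHom_apply_θint (AdjoinRoot.root (cubicPolyMod p)) (root_rel p)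
  refine ⟨ψ, hψ, ?_⟩
  -- `(p)` is maximal and contained in the proper ideal `ker ψ`
  have hprime : (span {(p : 𝓞 K)}).IsPrime ∧ Irreducible (cubicPolyMod p) := by
    rcases hp with rfl | rfl
    · exact ⟨by simpa using span_two.1, fact_irreducible_cubicPolyMod_two.out⟩
    · exact ⟨by simpa using span_three.1, fact_irreducible_cubicPolyMod_three.out⟩
  haveI := hprime.1
  haveI : Fact p.Prime := ⟨by rcases hp with rfl | rfl <;> decide⟩
  haveI : Fact (Irreducible (cubicPolyMod p)) := ⟨hprime.2⟩
  have hp0 : (p : 𝓞 K) ≠ 0 := by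
    rcases hp with rfl | rfl <;> norm_num
  have hmax : (span {(p : 𝓞 K)}).IsMaximal :=
    IsPrime.isMaximal inferInstance (by rwa [Ne, span_singleton_eq_bot])
  have hle : span {(p : 𝓞 K)} ≤ RingHom.ker ψ := by
    rw [span_singleton_le_iff_mem, RingHom.mem_ker, map_natCast]
    have : ((p : ZMod p)) = 0 := ZMod.natCast_self p
    calc (p : AdjoinRoot (cubicPolyMod p)) = algebraMap (ZMod p) _ (p : ZMod p) := (map_natCast _ p).symm
      _ = 0 := by rw [this, map_zero]
  exact (hmax.eq_of_le (RingHom.ker_ne_top ψ) hle).symm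


/-! ### Elements with even valuations are units times squares (`h_K = 1`) -/

/-- **`K(∅, 2) = 𝓞ˣ/𝓞ˣ²` over a principal ideal domain**: a non-zero element `z` of the fraction
field of a Dedekind PID all of whose valuations are even is a unit times a square. (Integral
representative `z ≡ r (mod Kˣ²)` by the tree's `IsDedekindDomain.exists_mk_eq_of_pos`; `(r) = J²` by
unique factorisation of ideals, `exists_pow_eq_span_singleton_of_dvd_count`; `J = (w)`.) [folklore] -/
theorem exists_unit_mul_sq_of_even_valuation {R : Type*} [CommRing R] [IsDedekindDomain R]
    [IsPrincipalIdealRing R] {L : Type*} [Field L] [Algebra R L] [IsFractionRing R L] {z : L}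
    (hz : z ≠ 0)
    (h : ∀ v : IsDedekindDomain.HeightOneSpectrum R, (2 : ℤ) ∣ WithZero.log (v.valuation L z)) :
    ∃ (u : Rˣ) (w : L), z = algebraMap R L u * w ^ 2 := by
  classical
  set zU : Lˣ := Units.mk0 z hz with hzU
  obtain ⟨r, x, hr, hx, hclass⟩ := IsDedekindDomain.exists_mk_eq_of_pos (R := R) (K := L) two_pos
    (QuotientGroup.mk zU : Lˣ ⧸ (powMonoidHom 2 : Lˣ →* Lˣ).range)
  obtain ⟨t, ht⟩ := MonoidHom.mem_range.mp (QuotientGroup.eq.mp hclass)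
  rw [powMonoidHom_apply] at ht
  have hzx : zU = x * t ^ 2 := by rw [ht, mul_inv_cancel_left]
  -- the exponents of `(r)` are even
  have hcount : ∀ v : IsDedekindDomain.HeightOneSpectrum R,
      2 ∣ (Associates.mk v.asIdeal).count (Associates.mk (Ideal.span {r})).factors := by
    intro v
    have h1 := v.toAdd_valuationOfNeZero_of_eq_algebraMap (K := L) hr hx
    have h2 := v.toAdd_valuationOfNeZero_eq_log (K := L) zU
    have h3 : v.valuationOfNeZero (K := L) zU =
        v.valuationOfNeZero (K := L) x * (v.valuationOfNeZero (K := L) t) ^ 2 := by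
      rw [hzx, map_mul, map_pow]
    have h4 := congrArg Multiplicative.toAdd h3
    rw [toAdd_mul, toAdd_pow, h1, h2] at h4
    have hv : (2 : ℤ) ∣ WithZero.log (v.valuation L (zU : L)) := h v
    rw [h4] at hv
    have : (2 : ℤ) ∣ ((Associates.mk v.asIdeal).count (Associates.mk (Ideal.span {r})).factors : ℤ) := by
      have e : ((Associates.mk v.asIdeal).count (Associates.mk (Ideal.span {r})).factors : ℤ) =
          2 * Multiplicative.toAdd (v.valuationOfNeZero (K := L) t) -
            (-(((Associates.mk v.asIdeal).count (Associates.mk (Ideal.span {r})).factors : ℕ) : ℤ) +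
              2 • Multiplicative.toAdd (v.valuationOfNeZero (K := L) t)) := by ring
      rw [e]
      exact dvd_sub (dvd_mul_right 2 _) hv
    exact_mod_cast this
  obtain ⟨J, hJ⟩ := IsDedekindDomain.exists_pow_eq_span_singleton_of_dvd_count hr hcount
  -- `J = (w)`, `(r) = (w²)`, `r = w² u`
  obtain ⟨w, hw⟩ : ∃ w : R, J = Ideal.span {w} :=
    ⟨_, (IsPrincipalIdealRing.principal J).span_singleton_generator.symm⟩
  rw [hw, Ideal.span_singleton_pow, Ideal.span_singleton_eq_span_singleton] at hJ
  obtain ⟨u, hu⟩ := hJ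
  refine ⟨u, algebraMap R L w * t, ?_⟩
  have hzL : z = (x : L) * (t : L) ^ 2 := by
    have := congrArg (fun y : Lˣ => (y : L)) hzx
    simpa [hzU] using this
  rw [hzL, hx, ← hu, map_mul, map_pow, mul_pow]
  ring


end CyclicCubic13

end Literature.NumberTheory.NumberFields

end
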